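import Literature.Probability.RandomPlanarGeometry.SAWManhattanLattice
import Literature.Probability.RandomPlanarGeometry.HexSAWTheorem1
import Literature.Probability.RandomPlanarGeometry.BDGS2012CountBoundsProofs
import HarnessLib

/-!
# `μ_Manhattan < μ_hex < μ(ℤ²)`: three consecutive turns close a Manhattan walk, a tribonacci majorant,
# and Duminil-Copin–Smirnov's `√(2+√2)`

Topic `Literature/Probability/RandomPlanarGeometry` (continues `SAWManhattanLattice.lean`: `Zd.IsManhattanArc`,
`Zd.manhattanWalks N`, `Zd.manhattanCount N = c^M_N`, `Zd.logMuM = log μ_M`, `Zd.logMuM_le`,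
`Zd.manhattanCount_add_le`).

## What the sources print

* A. Malakis, *Self-avoiding walks on oriented square lattices*, J. Phys. A 8 (1975) 1885–1898, abstract: "Rigorous
  upper and lower bounds together with estimates are presented for the connective constant `μ` … for both the
  oriented square lattices" (the Manhattan and the `L` lattice); the printed bound VALUES are not held by the lane
  (acq-10170), so no comparison with them is claimed.
* A. Blanca, Y. Chen, D. Galvin, D. Randall, P. Tetali, *Phase coexistence for the hard-core model on `ℤ²`*,
  Combin. Probab. Comput. 28 (2019) (arXiv:1611.01115), §2, Definition 2.1 and Lemma 2.1 (p. 6): TAXI walks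
  (Manhattan-oriented self-avoiding walks with no two consecutive turns) are encoded by words over `{s, t}`
  (straight/turn) with no factor `tt`, whence a Fibonacci majorant. The device below is the same encoding pushed
  one letter: UNRESTRICTED Manhattan self-avoiding walks have no factor `ttt`, whence a tribonacci majorant.
* H. Duminil-Copin, S. Smirnov, Ann. of Math. 175 (2012), Theorem 1: `μ_hex = √(2+√2)` (tree:
  `DuminilCopinSmirnov2012_thm1_holds`, `hexConnectiveConstant_eq_of_thm1`).
* R. Bauerschmidt, H. Duminil-Copin, J. Goodman, G. Slade, *Lectures on self-avoiding walks* (2012), Table 1: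
  `μ(ℤ²) ≥ 2.6` (tree: `Zd.BDGS2012_connectiveConstant_bounds_holds`).
* Numerics (folklore, not used): `μ_M ≈ 1.7335` (Enting–Guttmann 1985), `μ_hex = 1.84776`, tribonacci constant
  `1.83929` (real root of `x³ = x² + x + 1`).

## What is here (namespace `Literature.Probability.RandomPlanarGeometry.SAW.Zd`)

* `manhattanArc_coords`, `manhattanArc_det` (one outgoing street arc and one outgoing avenue arc per site),
  **`manhattanArc_three_turns`** — three consecutive turns run round a unit block (`e = a`), so a
  self-avoiding Manhattan walk never turns three times in a row;
* `IsStreetStep`, `truncWalk`, `manhattanWalks_eq_of_agree` (a Manhattan walk is its prefix plus its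
  orientation word), `manhattanCount_succ_le` (`c^M_{n+1} ≤ 2c^M_n`),
  **`manhattanCount_add_four_le`** (`c^M_{M+4} ≤ c^M_{M+3} + c^M_{M+2} + c^M_{M+1}`, by the length of the
  trailing run of turns);
* `tribCount` (`1, 2, 4, 7, 13, 24, …`, binary words without `TTT`), **`manhattanCount_succ_le_two_mul_tribCount`**
  (`c^M_{N+1} ≤ 2 t(N)`; exact for `N + 1 ≤ 7`), `tribCount_le_pow` (`t(N) ≤ (46/25)^{N+2}`),
  `manhattanCount_succ_le_pow`, **`logMuM_le_log` (`log μ_M ≤ log (46/25)`, i.e. `μ_M ≤ 1.84`)**;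
* **`exp_logMuM_lt_hexConnectiveConstant` — `μ_Manhattan < μ_hex`** (one rational certificate
  `2·(46/25)^401 < (17071/5000)^200 ≤ (2+√2)^200 = μ_hex^400` against `c^M_400 ≤ 2·(46/25)^401`; margin `0.42 %`;
  no enumeration), and **`hexConnectiveConstant_lt_connectiveConstant` — `μ_hex < μ(ℤ²)`** (`√(2+√2) < 2 ≤ 2.6`).

Printed status (lane «pcv-sawmu» route R58 «φ-SANDWICH / 2D-ORDER», a-idea-2 ROUTES §42, custody a-idea-2; proofs
= a-idea-2's `Sketch_v10B_MANTTT` / `Sketch_v10T_TRIB` ported): the `{s,t}`-word device is printed for taxi walks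
(BCGRT 2019 Lemma 2.1); the `ttt`-closure for all Manhattan self-avoiding walks, the tribonacci majorant and the
separation `μ_M ≤ 46/25 < √(2+√2) = μ_hex` are not found in print (numerically folklore). The lower links
`μ_L ≤ φ < 81/50 ≤ μ_M` are `SAWManhattanBlocks.lean` (a-p3); the assembled planar order
`μ_L < μ_M < μ_hex < μ(ℤ²)` is stated where the last of the two files lands.
-/

noncomputable section

open Finset Filter Topology
open Literature.Probability.LatticeModels Literature.Probability.Percolation SimpleGraph

namespace Literature.Probability.RandomPlanarGeometry.SAW.Zd

/-! ### Manhattan arcs in coordinates -/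

/-- `c^M_0 ≤ 1` (the only `0`-step walk is the constant one). [cite: Malakis1975, abstract] -/
theorem manhattanCount_zero_le : manhattanCount 0 ≤ 1 := by
  unfold manhattanCount
  refine (Finset.card_le_card (manhattanWalks_subset_saws 0)).trans ?_
  rw [card_saws, count_zero]

/-- Integer face of a Manhattan arc `x → y`: horizontal (`y₁ = x₁`, `y₀ = x₀ ± 1`, `+` iff `x₁` even) or vertical
(`y₀ = x₀`, `y₁ = x₁ ± 1`, `+` iff `x₀` odd). [cite: Malakis1975, abstract] -/
theorem manhattanArc_coords {x y : Site 2} (h : IsManhattanArc x y) :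
    ((y 1 = x 1 ∧ (y 0 = x 0 + 1 ∨ y 0 = x 0 - 1)) ∨ (y 0 = x 0 ∧ (y 1 = x 1 + 1 ∨ y 1 = x 1 - 1))) ∧
      (y 1 = x 1 → (y 0 = x 0 + 1 ↔ x 1 % 2 = 0)) ∧ (y 0 = x 0 → (y 1 = x 1 + 1 ↔ x 0 % 2 = 1)) := by
  obtain ⟨hadj, hh, hv⟩ := h
  simp only [Pi.sub_apply, Int.even_iff] at hh hv
  have hstep : (y 1 = x 1 ∧ (y 0 = x 0 + 1 ∨ y 0 = x 0 - 1)) ∨ (y 0 = x 0 ∧ (y 1 = x 1 + 1 ∨ y 1 = x 1 - 1)) := by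
    obtain ⟨i, hi | hi⟩ := (zdGraph_adj_iff_sub x y).1 hadj
    · have h0 := congrFun hi 0
      have h1 := congrFun hi 1
      fin_cases i <;> simp at h0 h1 <;> omega
    · have h0 := congrFun hi 0
      have h1 := congrFun hi 1
      fin_cases i <;> simp at h0 h1 <;> omega
  refine ⟨hstep, fun h1 => ?_, fun h0 => ?_⟩
  · have key := hh (by omega)
    constructor
    · intro e; exact key.1 (by omega)
    · intro e; have := key.2 e; omega
  · have key := hv (by omega)
    constructor
    · intro e; have := key.1 (by omega); omega
    · intro e; have := key.2 (by omega); omega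

/-- A Manhattan arc out of `x` is determined by its orientation (horizontal iff the street index is kept): every
site of the Manhattan lattice has exactly one outgoing street arc and one outgoing avenue arc.
[cite: Malakis1975, abstract] -/
theorem manhattanArc_det {x y y' : Site 2} (h : IsManhattanArc x y) (h' : IsManhattanArc x y')
    (hs : (y 1 = x 1 ↔ y' 1 = x 1)) : y = y' := by
  obtain ⟨hst, hh, hv⟩ := manhattanArc_coords h
  obtain ⟨hst', hh', hv'⟩ := manhattanArc_coords h'
  have h0 : y 0 = y' 0 := by omega
  have h1 : y 1 = y' 1 := by omega
  funext j
  fin_cases j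
  · exact h0
  · exact h1

/-- Propositional glue: if the orientation flips at the same time on two walks and the earlier orientations agree,
the later ones agree. [folklore] -/
private theorem iff_of_turns {X Y X' Y' : Prop} (p : ¬ (X ↔ Y)) (p' : ¬ (X' ↔ Y')) (hY : (Y ↔ Y')) : (X ↔ X') := by
  constructor
  · intro hx
    by_contra hx'
    have hy : ¬ Y := fun hy => p ⟨fun _ => hy, fun _ => hx⟩
    have hy' : ¬ Y' := fun hy' => hy (hY.2 hy')
    exact p' ⟨fun h => absurd h hx', fun h => absurd h hy'⟩
  · intro hx'
    by_contra hx
    have hy' : ¬ Y' := fun hy' => p' ⟨fun _ => hy', fun _ => hx'⟩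
    have hy : ¬ Y := fun hy => hy' (hY.1 hy)
    exact p ⟨fun h => absurd h hx, fun h => absurd h hy⟩

/-- **Three consecutive turns close a unit block.** If `a → b → c → d → e` are Manhattan arcs and the orientation
changes at `b`, at `c` and at `d`, then `e = a`: consecutive turns on the Manhattan lattice have the same rotational
sense. [cite: Malakis1975, abstract] -/
theorem manhattanArc_three_turns {a b c d e : Site 2} (h1 : IsManhattanArc a b) (h2 : IsManhattanArc b c)
    (h3 : IsManhattanArc c d) (h4 : IsManhattanArc d e)
    (t1 : ¬ (c 1 = b 1 ↔ b 1 = a 1)) (t2 : ¬ (d 1 = c 1 ↔ c 1 = b 1)) (t3 : ¬ (e 1 = d 1 ↔ d 1 = c 1)) :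
    e = a := by
  obtain ⟨s1, p1, q1⟩ := manhattanArc_coords h1
  obtain ⟨s2, p2, q2⟩ := manhattanArc_coords h2
  obtain ⟨s3, p3, q3⟩ := manhattanArc_coords h3
  obtain ⟨s4, p4, q4⟩ := manhattanArc_coords h4
  have key : e 0 = a 0 ∧ e 1 = a 1 := by
    rcases s1 with ⟨b1e, b0e⟩ | ⟨b0e, b1e⟩
    · -- arc 1 horizontal ⇒ arc 2 vertical ⇒ arc 3 horizontal ⇒ arc 4 vertical
      have c1ne : c 1 ≠ b 1 := fun h => t1 ⟨fun _ => b1e, fun _ => h⟩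
      rcases s2 with ⟨c1e, _⟩ | ⟨c0e, c1e⟩
      · exact absurd c1e c1ne
      have d1e : d 1 = c 1 := by
        by_contra h
        exact t2 ⟨fun h' => absurd h' h, fun h' => absurd h' c1ne⟩
      rcases s3 with ⟨_, d0e⟩ | ⟨_, d1e'⟩
      swap
      · omega
      have e1ne : e 1 ≠ d 1 := fun h => t3 ⟨fun _ => d1e, fun _ => h⟩
      rcases s4 with ⟨e1e, _⟩ | ⟨e0e, e1e⟩
      · exact absurd e1e e1ne
      have P1 := p1 b1e
      have Q2 := q2 c0e
      have P3 := p3 d1e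
      have Q4 := q4 e0e
      constructor <;> omega
    · -- arc 1 vertical ⇒ arc 2 horizontal ⇒ arc 3 vertical ⇒ arc 4 horizontal
      have b1ne : b 1 ≠ a 1 := by omega
      have c1e : c 1 = b 1 := by
        by_contra h
        exact t1 ⟨fun h' => absurd h' h, fun h' => absurd h' b1ne⟩
      rcases s2 with ⟨_, c0e⟩ | ⟨_, c1e'⟩
      swap
      · omega
      have d1ne : d 1 ≠ c 1 := fun h => t2 ⟨fun _ => c1e, fun _ => h⟩
      rcases s3 with ⟨d1e, _⟩ | ⟨d0e, d1e⟩
      · exact absurd d1e d1ne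
      have e1e : e 1 = d 1 := by
        by_contra h
        exact t3 ⟨fun h' => absurd h' h, fun h' => absurd h' d1ne⟩
      rcases s4 with ⟨_, e0e⟩ | ⟨_, e1e'⟩
      swap
      · omega
      have Q1 := q1 b0e
      have P2 := p2 c1e
      have Q3 := q3 d0e
      have P4 := p4 e1e
      constructor <;> omega
  funext j
  fin_cases j
  · exact key.1
  · exact key.2

/-! ### Orientation words and truncation -/

/-- Orientation of step `k` of `ω`: horizontal iff the street index is unchanged. [cite: Malakis1975, abstract] -/
def IsStreetStep (ω : ℕ → Site 2) (k : ℕ) : Prop := ω (k + 1) 1 = ω k 1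

/-- `IsStreetStep` depends only on `ω k`, `ω (k+1)`. [folklore] -/
private theorem isStreetStep_congr {ω ω' : ℕ → Site 2} {k : ℕ} (h1 : ω k = ω' k) (h2 : ω (k + 1) = ω' (k + 1)) :
    (IsStreetStep ω k ↔ IsStreetStep ω' k) := by
  unfold IsStreetStep; rw [h1, h2]

/-- Truncation of a walk to its first `k` steps (frozen after time `k`). [cite: MadrasSlade1993, §1.2, Lemma 1.2.2] -/
def truncWalk (k : ℕ) (ω : ℕ → Site 2) : ℕ → Site 2 := fun i => ω (min i k)

/-- `truncWalk k ω i = ω i` for `i ≤ k`. [folklore] -/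
private theorem truncWalk_apply_of_le {k i : ℕ} (ω : ℕ → Site 2) (hi : i ≤ k) : truncWalk k ω i = ω i := by
  simp [truncWalk, min_eq_left hi]

/-- Truncation maps `manhattanWalks n` into `manhattanWalks k` for `k ≤ n`. [cite: MadrasSlade1993, §1.2, Lemma 1.2.2] -/
theorem truncWalk_mem_manhattanWalks {n k : ℕ} (hk : k ≤ n) {ω : ℕ → Site 2} (hω : ω ∈ manhattanWalks n) :
    truncWalk k ω ∈ manhattanWalks k := by
  rw [mem_manhattanWalks] at hω ⊢
  obtain ⟨hs, hman⟩ := hω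
  rw [mem_saws] at hs ⊢
  obtain ⟨h0, hend, hadj, hinj⟩ := hs
  refine ⟨⟨by simp [truncWalk, h0], fun i hi => by simp [truncWalk, min_eq_right hi], fun i hi => ?_, ?_⟩,
    fun j hj => ?_⟩
  · rw [truncWalk_apply_of_le ω hi.le, truncWalk_apply_of_le ω (by omega)]
    exact hadj i (by omega)
  · intro i hi j hj hij
    simp only [Set.mem_setOf_eq] at hi hj
    rw [truncWalk_apply_of_le ω hi, truncWalk_apply_of_le ω hj] at hij
    exact hinj (by simp only [Set.mem_setOf_eq]; omega) (by simp only [Set.mem_setOf_eq]; omega) hij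
  · rw [truncWalk_apply_of_le ω hj.le, truncWalk_apply_of_le ω (by omega)]
    exact hman j (by omega)

/-- Equal truncations give equal prefixes. [folklore] -/
private theorem eq_of_truncWalk_eq {k : ℕ} {ω ω' : ℕ → Site 2} (heq : truncWalk k ω = truncWalk k ω') :
    ∀ i, i ≤ k → ω i = ω' i := fun i hi => by
  have := congrFun heq i
  rwa [truncWalk_apply_of_le ω hi, truncWalk_apply_of_le ω' hi] at this

/-- Two Manhattan self-avoiding walks agreeing up to time `k` and with equal step orientations afterwards are
equal (a Manhattan walk is its first step plus its orientation word). [cite: Malakis1975, abstract] -/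
theorem manhattanWalks_eq_of_agree {n k : ℕ} {ω ω' : ℕ → Site 2} (hω : ω ∈ manhattanWalks n)
    (hω' : ω' ∈ manhattanWalks n) (hup : ∀ i, i ≤ k → ω i = ω' i)
    (hstep : ∀ i, k ≤ i → i < n → (∀ j, j ≤ i → ω j = ω' j) → (IsStreetStep ω i ↔ IsStreetStep ω' i)) :
    ω = ω' := by
  rw [mem_manhattanWalks, mem_saws] at hω hω'
  obtain ⟨⟨-, hend, -, -⟩, hman⟩ := hω
  obtain ⟨⟨-, hend', -, -⟩, hman'⟩ := hω'
  have key : ∀ i, i ≤ n → ∀ j, j ≤ i → ω j = ω' j := by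
    intro i
    induction i with
    | zero => intro _ j hj; exact hup j (by omega)
    | succ i ih =>
      intro hi j hj
      rcases Nat.lt_or_ge j (i + 1) with hji | hji
      · exact ih (by omega) j (by omega)
      · have hj' : j = i + 1 := by omega
        subst hj'
        rcases Nat.lt_or_ge i k with hik | hik
        · exact hup (i + 1) (by omega)
        · have hprev := ih (by omega)
          have hi_eq : ω i = ω' i := hprev i le_rfl
          have hor := hstep i hik (by omega) hprev
          unfold IsStreetStep at hor
          have a1 := hman i (by omega)
          have a2 := hman' i (by omega)
          rw [← hi_eq] at a2 hor
          exact manhattanArc_det a1 a2 hor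
  funext i
  rcases Nat.lt_or_ge n i with hi | hi
  · rw [hend i hi.le, hend' i hi.le]; exact key n le_rfl n le_rfl
  · exact key n le_rfl i hi

/-! ### The tribonacci recursion -/

/-- `c^M_{n+1} ≤ 2 c^M_n`: a Manhattan site has out-degree `2`, one arc per orientation. [cite: Malakis1975, abstract] -/
theorem manhattanCount_succ_le (n : ℕ) : manhattanCount (n + 1) ≤ 2 * manhattanCount n := by
  classical
  have h := Finset.card_le_card_of_injOn (s := manhattanWalks (n + 1))
    (t := manhattanWalks n ×ˢ (Finset.univ : Finset Bool))
    (fun ω => (truncWalk n ω, decide (IsStreetStep ω n))) ?_ ?_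
  · have h' : manhattanCount (n + 1) ≤ manhattanCount n * 2 := by
      simpa [manhattanCount, Finset.card_product] using h
    omega
  · intro ω hω
    rw [Finset.mem_coe] at hω
    rw [Finset.mem_coe, Finset.mem_product]
    exact ⟨truncWalk_mem_manhattanWalks (by omega) hω, Finset.mem_univ _⟩
  · intro ω hω ω' hω' heq
    rw [Finset.mem_coe] at hω hω'
    simp only [Prod.mk.injEq] at heq
    obtain ⟨htr, hb⟩ := heq
    refine manhattanWalks_eq_of_agree hω hω' (eq_of_truncWalk_eq htr) fun i hi hin _ => ?_
    have : i = n := by omega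
    subst this
    rwa [decide_eq_decide] at hb

/-- **The tribonacci recursion** `c^M_{M+4} ≤ c^M_{M+3} + c^M_{M+2} + c^M_{M+1}`: split the `(M+4)`-step walks by
the length of the trailing run of turns — `0`, `1` or `2` turns are determined by the first `M+3`, `M+2`, `M+1`
steps respectively, and `3` trailing turns are impossible (`manhattanArc_three_turns` + self-avoidance).  (The
unshifted `c_{M+3} ≤ c_{M+2} + c_{M+1} + c_M` fails at `M = 0`: `8 > 7`.) [cite: Malakis1975, abstract] -/
theorem manhattanCount_add_four_le (M : ℕ) :
    manhattanCount (M + 4) ≤ manhattanCount (M + 3) + manhattanCount (M + 2) + manhattanCount (M + 1) := by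
  classical
  set W := manhattanWalks (M + 4) with hW
  set A := W.filter fun ω => (IsStreetStep ω (M + 3) ↔ IsStreetStep ω (M + 2)) with hA
  set B := W.filter fun ω => ¬ (IsStreetStep ω (M + 3) ↔ IsStreetStep ω (M + 2)) ∧
    (IsStreetStep ω (M + 2) ↔ IsStreetStep ω (M + 1)) with hB
  set C := W.filter fun ω => ¬ (IsStreetStep ω (M + 3) ↔ IsStreetStep ω (M + 2)) ∧
    ¬ (IsStreetStep ω (M + 2) ↔ IsStreetStep ω (M + 1)) ∧ (IsStreetStep ω (M + 1) ↔ IsStreetStep ω M) with hC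
  have hcover : W ⊆ A ∪ B ∪ C := by
    intro ω hω
    simp only [Finset.mem_union, hA, hB, hC, Finset.mem_filter]
    by_cases h3 : (IsStreetStep ω (M + 3) ↔ IsStreetStep ω (M + 2))
    · exact Or.inl (Or.inl ⟨hω, h3⟩)
    by_cases h2 : (IsStreetStep ω (M + 2) ↔ IsStreetStep ω (M + 1))
    · exact Or.inl (Or.inr ⟨hω, h3, h2⟩)
    by_cases h1 : (IsStreetStep ω (M + 1) ↔ IsStreetStep ω M)
    · exact Or.inr ⟨hω, h3, h2, h1⟩
    exfalso
    have hω' := hω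
    rw [hW, mem_manhattanWalks, mem_saws] at hω'
    obtain ⟨⟨-, -, -, hinj⟩, hman⟩ := hω'
    unfold IsStreetStep at h1 h2 h3
    have e := manhattanArc_three_turns (hman M (by omega)) (hman (M + 1) (by omega)) (hman (M + 2) (by omega))
      (hman (M + 3) (by omega)) h1 h2 h3
    have := hinj (show M + 3 + 1 ∈ {i | i ≤ M + 4} by simp) (show M ∈ {i | i ≤ M + 4} by simp) e
    omega
  have hAc : A.card ≤ manhattanCount (M + 3) := by
    refine Finset.card_le_card_of_injOn (truncWalk (M + 3)) (fun ω hω => ?_) ?_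
    · rw [Finset.mem_coe, hA, Finset.mem_filter] at hω
      exact truncWalk_mem_manhattanWalks (by omega) hω.1
    · intro ω hω ω' hω' heq
      rw [Finset.mem_coe, hA, Finset.mem_filter] at hω hω'
      refine manhattanWalks_eq_of_agree hω.1 hω'.1 (eq_of_truncWalk_eq heq) fun i hi hin hag => ?_
      have : i = M + 3 := by omega
      subst this
      have hY := isStreetStep_congr (k := M + 2) (hag _ (by omega)) (hag _ (by omega))
      exact hω.2.trans (hY.trans hω'.2.symm)
  have hBc : B.card ≤ manhattanCount (M + 2) := by
    refine Finset.card_le_card_of_injOn (truncWalk (M + 2)) (fun ω hω => ?_) ?_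
    · rw [Finset.mem_coe, hB, Finset.mem_filter] at hω
      exact truncWalk_mem_manhattanWalks (by omega) hω.1
    · intro ω hω ω' hω' heq
      rw [Finset.mem_coe, hB, Finset.mem_filter] at hω hω'
      refine manhattanWalks_eq_of_agree hω.1 hω'.1 (eq_of_truncWalk_eq heq) fun i hi hin hag => ?_
      rcases (show i = M + 2 ∨ i = M + 3 by omega) with rfl | rfl
      · have hY := isStreetStep_congr (k := M + 1) (hag _ (by omega)) (hag _ (by omega))
        exact hω.2.2.trans (hY.trans hω'.2.2.symm)
      · have hY := isStreetStep_congr (k := M + 2) (hag _ (by omega)) (hag _ (by omega))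
        exact iff_of_turns hω.2.1 hω'.2.1 hY
  have hCc : C.card ≤ manhattanCount (M + 1) := by
    refine Finset.card_le_card_of_injOn (truncWalk (M + 1)) (fun ω hω => ?_) ?_
    · rw [Finset.mem_coe, hC, Finset.mem_filter] at hω
      exact truncWalk_mem_manhattanWalks (by omega) hω.1
    · intro ω hω ω' hω' heq
      rw [Finset.mem_coe, hC, Finset.mem_filter] at hω hω'
      refine manhattanWalks_eq_of_agree hω.1 hω'.1 (eq_of_truncWalk_eq heq) fun i hi hin hag => ?_
      rcases (show i = M + 1 ∨ i = M + 2 ∨ i = M + 3 by omega) with rfl | rfl | rfl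
      · have hY := isStreetStep_congr (k := M) (hag _ (by omega)) (hag _ (by omega))
        exact hω.2.2.2.trans (hY.trans hω'.2.2.2.symm)
      · have hY := isStreetStep_congr (k := M + 1) (hag _ (by omega)) (hag _ (by omega))
        exact iff_of_turns hω.2.2.1 hω'.2.2.1 hY
      · have hY := isStreetStep_congr (k := M + 2) (hag _ (by omega)) (hag _ (by omega))
        exact iff_of_turns hω.2.1 hω'.2.1 hY
  calc manhattanCount (M + 4) = W.card := rfl
    _ ≤ (A ∪ B ∪ C).card := Finset.card_le_card hcover
    _ ≤ (A ∪ B).card + C.card := Finset.card_union_le _ _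
    _ ≤ A.card + B.card + C.card := by have := Finset.card_union_le A B; omega
    _ ≤ _ := by omega

/-- `t(N)`: the number of binary words of length `N` with no factor `TTT` (`1, 2, 4, 7, 13, 24, 44, 81, 149, …`,
tribonacci-type, growth rate `1.8393`). [folklore] -/
def tribCount : ℕ → ℕ
  | 0 => 1
  | 1 => 2
  | 2 => 4
  | n + 3 => tribCount (n + 2) + tribCount (n + 1) + tribCount n

/-- The defining recursion of `tribCount` (the `ttt`-free analogue of the Fibonacci recursion of BCGRT's
`tt`-free taxi words). [cite: BlancaChenGalvinRandallTetali2019, §2, Lemma 2.1 (device)] -/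
theorem tribCount_add_three (n : ℕ) :
    tribCount (n + 3) = tribCount (n + 2) + tribCount (n + 1) + tribCount n := rfl

/-- **«MAN-TTT»**: `c^M_{N+1} ≤ 2·t(N)` — a Manhattan self-avoiding walk is its first step (`2` choices) plus its
turn word, which has no three consecutive turns (the `{s,t}`-encoding of BCGRT's taxi walks, one letter further).
Exact for `N + 1 ≤ 7` (`2, 4, 8, 14, 26, 48, 88`); first slack at `8` (`154 < 162`).
[cite: BlancaChenGalvinRandallTetali2019, §2, Definition 2.1 and Lemma 2.1] [cite: Malakis1975, abstract] -/
theorem manhattanCount_succ_le_two_mul_tribCount (N : ℕ) : manhattanCount (N + 1) ≤ 2 * tribCount N := by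
  induction N using Nat.strong_induction_on with
  | _ N ih =>
    rcases Nat.lt_or_ge N 3 with hN | hN
    · have h0 := manhattanCount_zero_le
      have h1 : manhattanCount 1 ≤ 2 * manhattanCount 0 := manhattanCount_succ_le 0
      have h2 : manhattanCount 2 ≤ 2 * manhattanCount 1 := manhattanCount_succ_le 1
      have h3 : manhattanCount 3 ≤ 2 * manhattanCount 2 := manhattanCount_succ_le 2
      interval_cases N
      · show manhattanCount 1 ≤ 2 * 1
        omega
      · show manhattanCount 2 ≤ 2 * 2
        omega
      · show manhattanCount 3 ≤ 2 * 4
        omega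
    · obtain ⟨K, rfl⟩ : ∃ K, N = K + 3 := ⟨N - 3, by omega⟩
      have r := manhattanCount_add_four_le K
      have i2 : manhattanCount (K + 3) ≤ 2 * tribCount (K + 2) := ih (K + 2) (by omega)
      have i1 : manhattanCount (K + 2) ≤ 2 * tribCount (K + 1) := ih (K + 1) (by omega)
      have i0 : manhattanCount (K + 1) ≤ 2 * tribCount K := ih K (by omega)
      show manhattanCount (K + 4) ≤ 2 * tribCount (K + 3)
      rw [tribCount_add_three]
      omega

/-- `t(N) ≤ (46/25)^{N+2}` (`(46/25)^3 ≥ (46/25)^2 + 46/25 + 1`: `46/25 = 1.84` exceeds the tribonacci constant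
`1.83929`). [cite: BlancaChenGalvinRandallTetali2019, §2, Lemma 2.1 (device)] -/
theorem tribCount_le_pow (n : ℕ) : (tribCount n : ℝ) ≤ ((46 : ℝ) / 25) ^ (n + 2) := by
  induction n using Nat.strong_induction_on with
  | _ n ih =>
    rcases Nat.lt_or_ge n 3 with hn | hn
    · interval_cases n <;> norm_num [tribCount]
    · obtain ⟨m, rfl⟩ : ∃ m, n = m + 3 := ⟨n - 3, by omega⟩
      rw [tribCount_add_three]
      push_cast
      have h2 := ih (m + 2) (by omega)
      have h1 := ih (m + 1) (by omega)
      have h0 := ih m (by omega)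
      have hK : (0 : ℝ) ≤ ((46 : ℝ) / 25) ^ (m + 2) := by positivity
      have hnum : ((46 : ℝ) / 25) ^ 3 ≥ ((46 : ℝ) / 25) ^ 2 + (46 : ℝ) / 25 + 1 := by norm_num
      have e5 : ((46 : ℝ) / 25) ^ (m + 3 + 2) = ((46 : ℝ) / 25) ^ (m + 2) * ((46 : ℝ) / 25) ^ 3 := by ring
      have e4 : ((46 : ℝ) / 25) ^ (m + 2 + 2) = ((46 : ℝ) / 25) ^ (m + 2) * ((46 : ℝ) / 25) ^ 2 := by ring
      have e3 : ((46 : ℝ) / 25) ^ (m + 1 + 2) = ((46 : ℝ) / 25) ^ (m + 2) * ((46 : ℝ) / 25) := by ring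
      rw [e5]; rw [e4] at h2; rw [e3] at h1
      have := mul_le_mul_of_nonneg_left hnum.le hK
      nlinarith [this, h2, h1, h0]

/-- **Exponential upper bound** `c^M_{N+1} ≤ 2 · (46/25)^{N+2}` (so `μ_M ≤ 1.84`). [cite: Malakis1975, abstract] -/
theorem manhattanCount_succ_le_pow (N : ℕ) :
    (manhattanCount (N + 1) : ℝ) ≤ 2 * ((46 : ℝ) / 25) ^ (N + 2) := by
  have h1 : (manhattanCount (N + 1) : ℝ) ≤ 2 * (tribCount N : ℝ) := by
    exact_mod_cast manhattanCount_succ_le_two_mul_tribCount N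
  have h2 := tribCount_le_pow N
  linarith

/-- The one rational certificate: `2 · (46/25)^401 < (17071/5000)^200`. [folklore] -/
private theorem manhattan_ratCert : (2 : ℝ) * ((46 : ℝ) / 25) ^ 401 < ((17071 : ℝ) / 5000) ^ 200 := by
  rw [show (401 : ℕ) = 200 + 200 + 1 from rfl, pow_add, pow_add, pow_one,
    show (200 : ℕ) = 100 + 100 from rfl, pow_add, pow_add]
  norm_num

/-- `17071/5000 ≤ 2 + √2`. [folklore] -/
private theorem rat_le_two_add_sqrt_two : (17071 : ℝ) / 5000 ≤ 2 + Real.sqrt 2 := by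
  have : (7071 : ℝ) / 5000 ≤ Real.sqrt 2 := Real.le_sqrt_of_sq_le (by norm_num)
  linarith

/-- **`μ_Manhattan < μ_hex`**: `exp (log μ_M) < √(2+√2)`, from `c^M_400 ≤ 2·(46/25)^401 < (2+√2)^200 = μ_hex^400`
(Duminil-Copin–Smirnov) — no enumeration. [cite: DuminilCopinSmirnov2012, Thm 1] [cite: Malakis1975, abstract] -/
theorem exp_logMuM_lt_hexConnectiveConstant : Real.exp logMuM < hexConnectiveConstant := by
  have hinf : logMuM ≤ Real.log (manhattanCount 400) / 400 := by
    have h := logMuM_le 399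
    have e2 : ((399 : ℕ) : ℝ) + 1 = 400 := by norm_num
    simp only [e2] at h
    exact h
  -- generalize the count away so that no tactic tries to evaluate it
  generalize hc : manhattanCount 400 = c at hinf
  have hr : (c : ℝ) ≤ 2 * ((46 : ℝ) / 25) ^ 401 := hc ▸ manhattanCount_succ_le_pow 399
  have hlog1 : Real.log c ≤ Real.log (2 * ((46 : ℝ) / 25) ^ 401) := by
    rcases Nat.eq_zero_or_pos c with h0 | hpos
    · simp only [h0, Nat.cast_zero, Real.log_zero]
      have : (1 : ℝ) ≤ ((46 : ℝ) / 25) ^ 401 := one_le_pow₀ (by norm_num)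
      exact Real.log_nonneg (this.trans (le_mul_of_one_le_left (by positivity) (by norm_num)))
    · exact Real.log_le_log (by exact_mod_cast hpos) hr
  have hspos : 0 < Real.sqrt (2 + Real.sqrt 2) := Real.sqrt_pos.2 (by positivity)
  have hs2 : Real.sqrt (2 + Real.sqrt 2) ^ 2 = 2 + Real.sqrt 2 := Real.sq_sqrt (by positivity)
  have hpow : ((17071 : ℝ) / 5000) ^ 200 ≤ Real.sqrt (2 + Real.sqrt 2) ^ 400 := by
    calc ((17071 : ℝ) / 5000) ^ 200 ≤ (2 + Real.sqrt 2) ^ 200 :=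
          pow_le_pow_left₀ (by norm_num) rat_le_two_add_sqrt_two 200
      _ = Real.sqrt (2 + Real.sqrt 2) ^ 400 := by rw [show (400 : ℕ) = 2 * 200 from rfl, pow_mul, hs2]
  have hlog2 : Real.log (2 * ((46 : ℝ) / 25) ^ 401) < Real.log (Real.sqrt (2 + Real.sqrt 2) ^ 400) :=
    Real.log_lt_log (by positivity) (lt_of_lt_of_le manhattan_ratCert hpow)
  rw [Real.log_pow] at hlog2
  push_cast at hlog2
  have hhex : hexConnectiveConstant = Real.sqrt (2 + Real.sqrt 2) :=
    hexConnectiveConstant_eq_of_thm1 DuminilCopinSmirnov2012_thm1_holds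
  rw [hhex, ← Real.log_lt_log_iff (Real.exp_pos _) hspos, Real.log_exp]
  have : Real.log c / 400 < Real.log (Real.sqrt (2 + Real.sqrt 2)) := by
    rw [div_lt_iff₀ (by norm_num : (0 : ℝ) < 400)]
    linarith
  linarith


/-! ### `μ_M ≤ 46/25` as a statement about `logMuM`, and `μ_hex < μ(ℤ²)` -/

/-- `a ≤ b + c/k` for all `k ≥ 1` forces `a ≤ b`. [folklore] -/
private theorem le_of_forall_le_add_div {a b c : ℝ} (h : ∀ k : ℕ, 1 ≤ k → a ≤ b + c / k) : a ≤ b := by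
  by_contra hab
  have hab' : b < a := lt_of_not_ge hab
  obtain ⟨k, hk⟩ := exists_nat_gt (c / (a - b))
  have hpos : 0 < a - b := by linarith
  have hkpos : (0 : ℝ) < (k : ℝ) + 1 := by positivity
  have h1 : c < ((k : ℝ) + 1) * (a - b) := by
    have : c / (a - b) < (k : ℝ) + 1 := by linarith
    rwa [div_lt_iff₀ hpos] at this
  have h2 := h (k + 1) (by omega)
  have h3 : c / ((k + 1 : ℕ) : ℝ) < a - b := by
    push_cast
    rw [div_lt_iff₀ hkpos]
    linarith
  linarith

/-- **`log μ_M ≤ log (46/25)`**, i.e. `μ_Manhattan ≤ 1.84` (the tribonacci majorant: `log μ_M ≤ log c^M_{N+1}/(N+1)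
≤ log(46/25) + (log 2 + log(46/25))/(N+1)` for every `N`). [cite: BlancaChenGalvinRandallTetali2019, §2, Lemma 2.1 (the {s,t}-word device, for taxi walks)]
[cite: Malakis1975, abstract] -/
theorem logMuM_le_log : logMuM ≤ Real.log ((46 : ℝ) / 25) := by
  set q : ℝ := (46 : ℝ) / 25 with hq
  have hq1 : 1 < q := by norm_num
  have hlq : 0 ≤ Real.log q := Real.log_nonneg hq1.le
  refine le_of_forall_le_add_div (c := Real.log 2 + Real.log q) fun k hk => ?_
  obtain ⟨N, rfl⟩ : ∃ N, k = N + 1 := ⟨k - 1, by omega⟩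
  have hN : (0 : ℝ) < (N : ℝ) + 1 := by positivity
  have h1 : logMuM ≤ Real.log (manhattanCount (N + 1)) / ((N : ℝ) + 1) := logMuM_le N
  have hc1 : (1 : ℝ) ≤ manhattanCount (N + 1) := by exact_mod_cast one_le_manhattanCount (N + 1)
  have h2 : Real.log (manhattanCount (N + 1)) ≤ Real.log 2 + ((N : ℝ) + 2) * Real.log q := by
    have hb := manhattanCount_succ_le_pow N
    calc Real.log (manhattanCount (N + 1)) ≤ Real.log (2 * q ^ (N + 2)) :=
          Real.log_le_log (by linarith) hb
      _ = Real.log 2 + ((N : ℝ) + 2) * Real.log q := by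
          rw [Real.log_mul (by norm_num) (by positivity), Real.log_pow]; push_cast; ring
  have h3 : Real.log (manhattanCount (N + 1)) / ((N : ℝ) + 1) ≤
      Real.log q + (Real.log 2 + Real.log q) / ((N + 1 : ℕ) : ℝ) := by
    push_cast
    rw [div_le_iff₀ hN, add_mul, div_mul_cancel₀ _ hN.ne']
    linarith
  exact h1.trans h3

/-- **`μ_hex < μ(ℤ²)`**: `√(2+√2) < 2 ≤ μ(ℤ²)` (Duminil-Copin–Smirnov's value; the square-lattice lower bound
`μ ≥ 2.6` of the tree's BDGS Table 1 file). [cite: DuminilCopinSmirnov2012, Thm 1] [cite: BDGS2012, Table 1] -/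
theorem hexConnectiveConstant_lt_connectiveConstant : hexConnectiveConstant < SAW.connectiveConstant := by
  have hhex : hexConnectiveConstant = Real.sqrt (2 + Real.sqrt 2) :=
    hexConnectiveConstant_eq_of_thm1 DuminilCopinSmirnov2012_thm1_holds
  have h2 : (2 : ℝ) ≤ SAW.connectiveConstant := by
    have := (BDGS2012_connectiveConstant_bounds_holds 2 (by norm_num)).1
    rw [connectiveConstant_two] at this
    exact_mod_cast this
  have h4 : Real.sqrt 4 = 2 := by
    rw [show (4 : ℝ) = 2 ^ 2 by norm_num, Real.sqrt_sq (by norm_num : (0 : ℝ) ≤ 2)]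
  have hs2 : Real.sqrt 2 < 2 :=
    calc Real.sqrt 2 < Real.sqrt 4 := Real.sqrt_lt_sqrt (by norm_num) (by norm_num)
      _ = 2 := h4
  have hlt : Real.sqrt (2 + Real.sqrt 2) < 2 :=
    calc Real.sqrt (2 + Real.sqrt 2) < Real.sqrt 4 := Real.sqrt_lt_sqrt (by positivity) (by linarith)
      _ = 2 := h4
  rw [hhex]; linarith

/-- **`μ_Manhattan < μ_hex < μ(ℤ²)`** — the two upper links of the planar order of connective constants.
[cite: DuminilCopinSmirnov2012, Thm 1] [cite: Malakis1975, abstract] -/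
theorem exp_logMuM_lt_hex_lt_square :
    Real.exp logMuM < hexConnectiveConstant ∧ hexConnectiveConstant < SAW.connectiveConstant :=
  ⟨exp_logMuM_lt_hexConnectiveConstant, hexConnectiveConstant_lt_connectiveConstant⟩

end Literature.Probability.RandomPlanarGeometry.SAW.Zd

end
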